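import Summits.HodgeConjecture.CorCM.HypDel.ExtAmbientReceptacleQArchC
import Literature.AlgebraicGeometry.ShimuraVarieties.UnitaryAuxiliaryLevelProduct
import Literature.AlgebraicGeometry.ShimuraVarieties.UnitaryAuxiliaryCarrierEmbedding
import Literature.AlgebraicGeometry.ShimuraVarieties.UnitaryAuxiliarySpecialPairsDense
import Literature.AlgebraicGeometry.ModuliOfAbelianVarieties.SiegelPrincipalLevelNormal
import Literature.NumberTheory.ComplexMultiplication.CMTypeRiemannForm
import HarnessLib

/-!
# `stub_frame` of the HDel crux workfile: `QArch.FrameExists'` (v5) is a theorem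

Cell `hodgecm-mathlib`, crux `HDel` (stmt-HodgeConjecture-24835), line `Cruxes/HDel/Lines/F1ExtHodgeType.lean`, stub
`stub_frame : QArch.FrameExists'` (★ `…HypDel.ExtAmbientReceptacleQArchC`, ruling T3-v5).  Deligne's auxiliary construction
[Del79, 2.3.10; Del71, 1.15, 5.11–5.12] for the I-1′ data `(L, H, τ, T, K₀, M, j, Φ, L₀, K)`:

* SCALARS `ξ₀ = ξ = n • (−ζ)` for Shimura's `Φ`-adapted purely imaginary `ζ` (★ `CMTypeLattice.exists_skew_adapted_integral`),
  so `IsAuxScalars M Φ ξ₀ ξ`;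
* FRAME: `Hᴴ = H` read off `Tᴴ H^τ T = J` (★ `transpose_map_complexConj_eq_of_frame`); the frame `F` of a polarization type `δ`
  adapted to the SPLIT LATTICE of the compact `K × L₀` (★ `exists_symplecticFrame_auxLevel_eq_prod`: `K × L₀ ≤ K̃(1)` and
  `K̃(N) = K_V(N) ×ˢ L_V(N)` for every `N`);
* `J_{β,Φ}(x) ∈ C0pm δ` (★ (g-b) `auxComplexStructure_mem_C0pm`);
* LEVEL: `N₁` with `K̃(N₁) ≤ K × L₀` (★ `exists_auxLevel_le_prod`, the cofinality of the auxiliary levels — `ũ_β` is an embedding);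
  for `N₁ ∣ N`, `0 < N`: `K̃(N) ≤ K̃(N₁) ≤ K × L₀` (★ `auxLevel_anti`), normality from `K_δ(N) ⊲ K_δ(1)` (★
  `principalLevelSubgroup_normal_in_one`), and the product sublevels `K_V(N) = {k | (k,1) ∈ K̃(N)}`, `L_V(N) = {t | (1,t) ∈ K̃(N)}`
  are open (★ `isOpen_auxLevel`) and compact (closed in the compact `K`, `L₀`).

HC_CM is proved only modulo the 7 printed citations until rung 0 closes; this file discharges one registered stub of the HDel line.
[cite: Deligne1979ShimuraVarieties, Prop. 2.3.10] [cite: Deligne1971TravauxShimura, Prop. 1.15, 5.11–5.12] [cite: Milne2005ShimuraVarieties, Lemma 5.13]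
-/

noncomputable section

-- every decl of this cell's Theorems files lives in `Summit.HodgeConjecture.HodgeConjecture.Theorems`, which
-- `linter.dupNamespace` flags; the lakefile turns the linter off tree-wide (weak option), restated here so stand-alone
-- elaboration is warning-free.
set_option linter.dupNamespace false

open Function MulAction Topology NumberField IsDedekindDomain Matrix
open scoped Matrix ComplexOrder
open Literature.AlgebraicGeometry Literature.AlgebraicGeometry.Motives
open Literature.NumberTheory.Automorphic Literature.NumberTheory.Automorphic.UnitaryGroup
open Literature.NumberTheory.Automorphic.Liu2021.AppendixC (C5.OpenCompactSubgroup C5.SmallLevel)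
open Literature.Geometry.ComplexHyperbolic Literature.Geometry.ComplexHyperbolic.BallModel
open Literature.AlgebraicGeometry.ShimuraVarieties Literature.AlgebraicGeometry.ShimuraVarieties.UnitaryCanonicalModel
open Literature.AlgebraicGeometry.ShimuraVarieties.UnitaryCanonicalModel.Aux
open Literature.AlgebraicGeometry.ModuliOfAbelianVarieties
open Literature.NumberTheory.ComplexMultiplication (CMTypeLattice.exists_skew_adapted_integral)
open Summit.HodgeConjecture.CorCM.HypDel.ExtReceptacle.QArch (IsAuxScalars IsProductLevel)
open Summit.HodgeConjecture.CorCM.HypDel.ExtReceptacle (QArch.FrameExists')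

namespace Summit.HodgeConjecture.HodgeConjecture.Theorems

/-- Imaginary parts scale under rational multiples: `Im ρ(q • x) = q · Im ρ(x)`. [folklore] -/
private theorem im_map_rat_smul {M : Type} [Field M] [NumberField M] (ρ : M →+* ℂ) (q : ℚ) (x : M) :
    (ρ (q • x)).im = (q : ℝ) * (ρ x).im := by
  rw [map_rat_smul, Rat.smul_def, Complex.mul_im, Complex.ratCast_re, Complex.ratCast_im, zero_mul, add_zero]

/-- A CM type is inhabited: some complex embedding lies in `Φ` (either `φ` or its conjugate). [folklore] -/
private theorem exists_mem_cmType {M : Type} [Field M] [NumberField M] (Φ : CMType M) : ∃ ρ : M →+* ℂ, ρ ∈ Φ.1 := by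
  obtain ⟨φ⟩ : Nonempty (M →+* ℂ) := inferInstance
  by_cases hφ : φ ∈ Φ.1
  · exact ⟨φ, hφ⟩
  · exact ⟨NumberField.ComplexEmbedding.conjugate φ, not_not.1 fun h => hφ ((Φ.2 φ).2 h)⟩

/-- **`stub_frame` (Q6a + Q6b + ξ-choice): `QArch.FrameExists'` holds** — for the I-1′ data there are auxiliary scalars
`ξ₀, ξ`, a polarization type `δ`, a symplectic frame `F` adapted to the split lattice of `K × L₀`, and a level `N₁ > 0` with
`K × L₀ ≤ K̃(1)`, and for every positive multiple `N` of `N₁`: `K̃(N) ≤ K × L₀`, `K̃(N)` normalised by `K × L₀`, and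
`K̃(N) = K_V ×ˢ L_V` a product of open compact sublevels `K_V ≤ K`, `L_V ≤ L₀`.
[cite: Deligne1979ShimuraVarieties, Prop. 2.3.10] [cite: Deligne1971TravauxShimura, Prop. 1.15, 5.11–5.12] -/
theorem stub_frame : QArch.FrameExists' := by
  intro L _ _ _ H τ T hT hpos hanis K₀ M _ _ _ j Φ hΦ L₀ K
  classical
  -- `H` is hermitian (read off the frame `Tᴴ H^τ T = J`)
  have hstar : (star : L → L) = IsCMField.complexConj L := funext fun x => rfl
  have hH : Hᴴ = H := by
    rw [Matrix.conjTranspose, Matrix.transpose_map, hstar]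
    exact transpose_map_complexConj_eq_of_frame hT
  -- the auxiliary scalars: `ξ = -ζ`, `ζ` Shimura's `Φ`-adapted purely imaginary element
  obtain ⟨ζ, hζc, hζpos, -⟩ := CMTypeLattice.exists_skew_adapted_integral Φ 1
  obtain ⟨ρ₀, hρ₀⟩ := exists_mem_cmType Φ
  have hξc : IsCMField.complexConj M (-ζ) = -(-ζ) := by rw [map_neg, hζc]
  have hξne : (-ζ : M) ≠ 0 := by
    intro h
    have h0 := hζpos ⟨ρ₀, hρ₀⟩
    rw [neg_eq_zero.1 h, map_zero, Complex.zero_im] at h0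
    exact lt_irrefl _ h0
  have hξim : ∀ ρ : Φ.1, (ρ.1 (-ζ)).im < 0 := fun ρ => by
    rw [map_neg, Complex.neg_im, neg_lt_zero]
    exact hζpos ρ
  -- the frame adapted to the split lattice of `K × L₀`
  obtain ⟨n, g, δ, F, hn, hg, hδ, hle1, hprod⟩ :=
    exists_symplecticFrame_auxLevel_eq_prod j H (-ζ) (-ζ) hH hξne hξne hξc hξc hanis K.1.1 L₀.1 K.1.2.2 L₀.2.2
  -- the scalars `n • ξ`
  have hsc : IsCMField.complexConj M ((n : ℚ) • (-ζ)) = -((n : ℚ) • (-ζ)) := by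
    rw [map_rat_smul, hξc, smul_neg]
  have him : ∀ ρ : Φ.1, (ρ.1 ((n : ℚ) • (-ζ))).im < 0 := fun ρ => by
    rw [im_map_rat_smul, Rat.cast_natCast]
    exact mul_neg_of_pos_of_neg (Nat.cast_pos.2 hn) (hξim ρ)
  -- the cofinal level
  obtain ⟨N₁, hN₁, hleN₁⟩ := exists_auxLevel_le_prod F K.1.2.1 L₀.2.1
  have hscal : IsAuxScalars M Φ ((n : ℚ) • (-ζ)) ((n : ℚ) • (-ζ)) :=
    ⟨hsc, hsc, fun ρ hρ => ⟨him ⟨ρ, hρ⟩, him ⟨ρ, hρ⟩⟩⟩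
  have hJ : ∀ x : Ball, auxComplexStructure F τ Φ T x ∈ C0pm δ := fun x =>
    auxComplexStructure_mem_C0pm F τ Φ T x hT him him hpos hΦ
  refine ⟨(n : ℚ) • (-ζ), (n : ℚ) • (-ζ), g, δ, F, N₁, hscal, hg, hδ, hJ, Nat.pos_of_ne_zero hN₁, hle1, ?_⟩
  intro N hN₁N hNpos
  have hN0 : N ≠ 0 := Nat.pos_iff_ne_zero.1 hNpos
  have hleN : auxLevel F N ≤ K.1.1.prod L₀.1 := (auxLevel_anti F hN₁N).trans hleN₁
  refine ⟨hleN, ?_, ?_⟩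
  · -- normality: `K_δ(N) ⊲ K_δ(1)` pulled back along `ũ_β`, using `K × L₀ ≤ K̃(1)`
    intro x hx y hy
    rw [mem_auxLevel_iff] at hy ⊢
    have hx1 : (auxToGspFin F x)⁻¹ ∈ principalLevelSubgroup δ 1 := Subgroup.inv_mem _ (hle1 hx)
    have h := principalLevelSubgroup_normal_in_one δ N hx1 hy
    rwa [inv_inv, ← map_inv, ← map_mul, ← map_mul] at h
  · -- the product sublevels `K_V(N) = {k | (k,1) ∈ K̃(N)}`, `L_V(N) = {t | (1,t) ∈ K̃(N)}`
    obtain ⟨KVs, hKVs⟩ : ∃ S : Subgroup ↥(finAdelic (↥(maximalRealSubfield L)) L (IsCMField.complexConj L) 3 H),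
        S = (auxLevel F N).comap (MonoidHom.inl _ _) := ⟨_, rfl⟩
    obtain ⟨LVs, hLVs⟩ : ∃ S : Subgroup ↥(torusFinAdelic M), S = (auxLevel F N).comap (MonoidHom.inr _ _) := ⟨_, rfl⟩
    have hsubK : KVs ≤ K.1.1 := fun k hk => by
      rw [hKVs] at hk
      exact (Subgroup.mem_prod.1 (hleN hk)).1
    have hsubL : LVs ≤ L₀.1 := fun t ht => by
      rw [hLVs] at ht
      exact (Subgroup.mem_prod.1 (hleN ht)).2
    have hopenK : IsOpen (KVs : Set ↥(finAdelic (↥(maximalRealSubfield L)) L (IsCMField.complexConj L) 3 H)) := by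
      rw [hKVs, Subgroup.coe_comap]
      exact (isOpen_auxLevel F hN0).preimage (continuous_id.prodMk continuous_const)
    have hopenL : IsOpen (LVs : Set ↥(torusFinAdelic M)) := by
      rw [hLVs, Subgroup.coe_comap]
      exact (isOpen_auxLevel F hN0).preimage (continuous_const.prodMk continuous_id)
    have hcompK : IsCompact (KVs : Set ↥(finAdelic (↥(maximalRealSubfield L)) L (IsCMField.complexConj L) 3 H)) :=
      K.1.2.2.of_isClosed_subset (Subgroup.isClosed_of_isOpen _ hopenK) hsubK
    have hcompL : IsCompact (LVs : Set ↥(torusFinAdelic M)) :=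
      L₀.2.2.of_isClosed_subset (Subgroup.isClosed_of_isOpen _ hopenL) hsubL
    have hKV₀ : KVs ≤ K₀.1 := hsubK.trans K.2
    have hprodN : IsProductLevel M F N KVs LVs := by
      rw [IsProductLevel, hKVs, hLVs]
      exact hprod N
    exact ⟨⟨⟨KVs, hopenK, hcompK⟩, hKV₀⟩, ⟨LVs, hopenL, hcompL⟩, hsubK, hsubL, hprodN⟩

/-- `QArch.FrameExists'` under the KEY's name (`stub_frame_holds`), for the workfile re-pointing `stub_frame := stub_frame_holds`.
[cite: Deligne1979ShimuraVarieties, Prop. 2.3.10] -/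
theorem stub_frame_holds : QArch.FrameExists' := stub_frame

end Summit.HodgeConjecture.HodgeConjecture.Theorems

end
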